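import Literature.RepresentationTheory.HeisenbergGroup.SchrodingerFrobenius
import Literature.RepresentationTheory.HeisenbergGroup.SchrodingerSiegelParabolic
import Literature.NumberTheory.Automorphic.LocalPiModulationInvariantFunctional
import Mathlib.LinearAlgebra.Matrix.NonsingularInverse
import HarnessLib

/-!
# Implementers of elements stabilising the modulation Lagrangian act on `evaluation at 0` by a scalar

Topic `RepresentationTheory/HeisenbergGroup`; namespace `Literature.RepresentationTheory.HeisenbergGroup`.  KERNEL ONLY:
theorems; no definition, no record, no named fact, no `sorry`.

In the Schrödinger model `ρ = schrodingerSB β ψ` on `𝒮(X)` (tree `SchrodingerModel.lean`: translations by `X`,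
MODULATIONS by `Y`), «evaluation at `0`» is the `Y`-invariant functional (MVW Chap. 2 II.6; uniqueness up to scalar =
tree `LocalPiModulationInvariantFunctional.lean`).  Let `s ∈ B₀(polar β)` (Weil's pseudosymplectic group) STABILISE the
Lagrangian `Y` up to the centre, i.e. `s · ((0,y),0) = ((0,y'),0)` for some `y'` (`hsY`; for `s = ofSymplectic σ` this
says `σ(0 × Y) ⊆ 0 × Y`, the elements of the parabolic `P(Y)`), and let `M` implement `s` on `ρ`.

* §1 (any pairing, any field of coefficients of characteristic compatible with `ψ`) **`Λ ∘ M` is `Y`-invariant for every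
  `Y`-invariant functional `Λ`** (`comp_implementer_invariant_inY`): `Λ(M ρ((0,y),0) f) = Λ(ρ(s·((0,y),0)) M f) = Λ(M f)`;
* §2 (a Gram pairing `⟨x, J y⟩` over a non-archimedean local field, `det J` a unit, `ψ` continuous non-trivial)
  **`(M f)(0) = c · f(0)` for a constant `c`** (`exists_apply_zero_comp_implementer_eq_mul`): evaluation at `0` is
  `Y`-invariant, so is `ev₀ ∘ M` by §1, and every modulation `x ↦ ψ(x ⬝ᵥ η)` is `ρ((0, J⁻¹η), 0)`, so
  `exists_eq_mul_eval_zero_of_modulation_invariant` applies.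

[MoeglinVignerasWaldspurger1987, Chap. 2 II.6] gives the explicit operators of the Siegel parabolic (`M[g]f(x) =
|det a|^{1/2} f(a*x)` for the Levi, multiplication by a character of second degree for the unipotent radical) — each
visibly maps `f ↦ f(0)` to a multiple of itself; the point of this file is that NO factorisation of `s` into Levi and
unipotent parts is needed: uniqueness of the `Y`-invariant functional suffices.

Written for the cell `hodgecm-mathlib` (fan B, rung B-IV, KEY `b4-howe-compact-irreducible`, node E4 of the doubling
proof of `MoeglinVignerasWaldspurger1987.mvw_IV4_rankOne_irreducibleOrZero`: for `p` in the Siegel parabolic `P_Δ` of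
`U(V ⊕ V⁻)` the Siegel–Weil functional satisfies `ev₀ ∘ M_p = c_p · ev₀` in the `ℓ_Δ`-model).  Nothing about theta lifts
is asserted here.

## References
* [MoeglinVignerasWaldspurger1987] C. Mœglin, M.-F. Vignéras, J.-L. Waldspurger, LNM 1291 (1987), Chap. 2 II.1 (A), II.6.
* [Weil1964] A. Weil, Acta Math. 111 (1964), Chap. I n° 13 (the operators `d₀(α)`, `t₀(f)`).
-/

set_option autoImplicit false

noncomputable section

namespace Literature.RepresentationTheory.HeisenbergGroup

open Literature.NumberTheory.Automorphic

universe u v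

/-! ## §1 Implementers of `Y`-stabilising elements preserve `Y`-invariance of functionals -/

section General

variable {R : Type u} [CommRing R] [TopologicalSpace R] {X Y : Type v} [AddCommGroup X] [Module R X] [AddCommGroup Y]
  [Module R Y] [TopologicalSpace X] [IsTopologicalAddGroup X]
  {β : X →ₗ[R] Y →ₗ[R] R} {ψ : AddChar R Circle} (hl : IsLocallyConstant (⇑ψ : R → Circle))
  (hb : ∀ y : Y, Continuous fun u : X => β u y)

/-- **if `s` stabilises the Lagrangian `Y` (elementwise, with no central component) and `M` implements `s`, then
`Λ ∘ M` is `Y`-invariant whenever `Λ` is.** [cite: MoeglinVignerasWaldspurger1987, Chap. 2 II.6] -/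
theorem comp_implementer_invariant_inY {s : Heisenberg.PseudoSymplectic (polar β)}
    {M : SchwartzBruhat X ≃ₗ[ℂ] SchwartzBruhat X} (hM : Implements (schrodingerSB β ψ hl hb) s M)
    (hsY : ∀ y : Y, ∃ y' : Y, s.act (inY β y) = inY β y') (Λ : SchwartzBruhat X →ₗ[ℂ] ℂ)
    (hΛ : ∀ (y : Y) (f : SchwartzBruhat X), Λ (schrodingerSB β ψ hl hb (inY β y) f) = Λ f)
    (y : Y) (f : SchwartzBruhat X) :
    Λ (M (schrodingerSB β ψ hl hb (inY β y) f)) = Λ (M f) := by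
  obtain ⟨y', hy'⟩ := hsY y
  rw [hM, hy', hΛ]

omit [TopologicalSpace R] [TopologicalSpace X] [IsTopologicalAddGroup X] hl hb in
/-- for Weil's section `ofSymplectic σ`, stabilising `Y` elementwise in `B₀` is the set-theoretic condition
`σ(0, y) ∈ 0 × Y` (the central correction `½(B(σw, σw) − B(w, w))` vanishes on `w = (0, y)` with `σ w = (0, y')`).
[cite: Weil1964, n° 5, pp. 150–151] -/
theorem act_ofSymplectic_inY_eq [Invertible (2 : R)] (σ : symplecticGroup (polar β)) {y y' : Y}
    (hσ : σ.1 ((0 : X), y) = ((0 : X), y')) : (ofSymplectic (polar β) σ).act (inY β y) = inY β y' := by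
  apply Heisenberg.ext
  · show (ofSymplectic (polar β) σ).σ (inY β y).v = (inY β y').v
    rw [ofSymplectic_σ, inY_v, inY_v]
    exact hσ
  · show (inY β y).t + (ofSymplectic (polar β) σ).f (inY β y).v = (inY β y').t
    rw [ofSymplectic_f, inY_v, inY_t, inY_t, hσ]
    simp only [polar_apply, map_zero, LinearMap.zero_apply, sub_self, mul_zero, add_zero]

end General

/-! ## §2 Gram pairings over a non-archimedean local field: `(M f)(0) = c · f(0)` -/

section Gram

variable {F : Type*} [Field F] [ValuativeRel F] [TopologicalSpace F] [IsNonarchimedeanLocalField F]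
  {ι : Type*} [Fintype ι] [DecidableEq ι] (J : Matrix ι ι F) (hJ : IsUnit J.det)
  {ψ : AddChar F Circle} (hl : IsLocallyConstant (⇑ψ : F → Circle))
  (hbJ : ∀ y : ι → F, Continuous fun u : ι → F => Matrix.toLinearMap₂' F J u y)

/-- evaluation at `0` on `𝒮(F^ι)`, a linear functional. (Inline term; no definition.)
`ev₀ f = f 0` is `Y`-invariant for `schrodingerSB ⟨·, J ·⟩ ψ`: `(ρ((0,y),0) f)(0) = ψ(⟨0, J y⟩) f(0) = f(0)`.
[cite: MoeglinVignerasWaldspurger1987, Chap. 2 II.6] -/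
theorem apply_zero_schrodingerSB_inY (y : ι → F) (f : SchwartzBruhat (ι → F)) :
    ((schrodingerSB (Matrix.toLinearMap₂' F J) ψ hl hbJ (inY _ y) f : SchwartzBruhat (ι → F)) : (ι → F) → ℂ) 0 =
      (f : (ι → F) → ℂ) 0 := by
  rw [schrodingerSB_apply]
  simp only [inY_t, inY_v, map_zero, LinearMap.zero_apply, AddChar.map_zero_eq_one, Circle.coe_one, one_mul,
    add_zero]

include hJ in
/-- **`(M f)(0) = c · f(0)`**: an implementer `M` of an element `s ∈ B₀` stabilising `Y` elementwise acts on evaluation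
at `0` by a scalar (`ψ` continuous non-trivial, `det J` a unit). [cite: MoeglinVignerasWaldspurger1987, Chap. 2 II.6] -/
theorem exists_apply_zero_comp_implementer_eq_mul (hψ : ψ.IsContinuousNontrivial)
    {s : Heisenberg.PseudoSymplectic (polar (Matrix.toLinearMap₂' F J))}
    {M : SchwartzBruhat (ι → F) ≃ₗ[ℂ] SchwartzBruhat (ι → F)}
    (hM : Implements (schrodingerSB (Matrix.toLinearMap₂' F J) ψ hl hbJ) s M)
    (hsY : ∀ y : ι → F, ∃ y' : ι → F, s.act (inY _ y) = inY _ y') :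
    ∃ c : ℂ, ∀ f : SchwartzBruhat (ι → F),
      ((M f : SchwartzBruhat (ι → F)) : (ι → F) → ℂ) 0 = c * (f : (ι → F) → ℂ) 0 := by
  -- the functional `ev₀ ∘ M`
  let Λ : SchwartzBruhat (ι → F) →ₗ[ℂ] ℂ :=
    { toFun := fun f => ((M f : SchwartzBruhat (ι → F)) : (ι → F) → ℂ) 0
      map_add' := fun f g => by rw [map_add]; rfl
      map_smul' := fun c f => by rw [map_smul]; rfl }
  have hev : ∀ (y : ι → F) (f : SchwartzBruhat (ι → F)),
      Λ (schrodingerSB (Matrix.toLinearMap₂' F J) ψ hl hbJ (inY _ y) f) = Λ f := by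
    intro y f
    -- `ev₀` itself is `Y`-invariant, hence so is `ev₀ ∘ M` (§1)
    let ev : SchwartzBruhat (ι → F) →ₗ[ℂ] ℂ :=
      { toFun := fun f => (f : (ι → F) → ℂ) 0
        map_add' := fun f g => rfl
        map_smul' := fun c f => rfl }
    exact comp_implementer_invariant_inY hl hbJ hM hsY ev (fun y f => apply_zero_schrodingerSB_inY J hl hbJ y f) y f
  -- every modulation `x ↦ ψ(x ⬝ᵥ η)` is `ρ((0, J⁻¹ η), 0)`
  refine exists_eq_mul_eval_zero_of_modulation_invariant Λ (fun η f g hg => ?_) hψ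
  obtain ⟨y, hy⟩ := (Matrix.mulVec_surjective_iff_isUnit.2 ((Matrix.isUnit_iff_isUnit_det J).2 hJ)) η
  have hgf : g = schrodingerSB (Matrix.toLinearMap₂' F J) ψ hl hbJ (inY _ y) f := by
    apply Subtype.ext
    funext x
    rw [hg x, schrodingerSB_apply]
    simp only [inY_t, inY_v, zero_add, add_zero, Matrix.toLinearMap₂'_apply']
    rw [← hy]
  rw [hgf, hev]

end Gram

end Literature.RepresentationTheory.HeisenbergGroup

end
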